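import Summits.KontsevichZagierPeriods.Zeta5Search.Certificates.TwoTaleOmegaBaseEnum
import Summits.KontsevichZagierPeriods.Zeta5Search.Certificates.TwoTaleOmegaBaseP1
import Summits.KontsevichZagierPeriods.Zeta5Search.Certificates.TwoTaleOmegaBaseP2
import Summits.KontsevichZagierPeriods.Zeta5Search.Certificates.TwoTaleOmegaBaseP3
import Summits.KontsevichZagierPeriods.Zeta5Search.Certificates.TwoTaleOmegaBaseP4
import Summits.KontsevichZagierPeriods.Zeta5Search.Certificates.TwoTaleOmegaBaseP5
import Summits.KontsevichZagierPeriods.Zeta5Search.Certificates.TwoTaleOmegaBaseP6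
import Summits.KontsevichZagierPeriods.Zeta5Search.Certificates.TwoTaleOmegaBaseP7

/-!
# ζ(2) two-tale line — the base TABLE consolidated: `q = −q̂` and `p = −p̂` facts per table point (cell `pub-zeta5`, certifier `cert-2`, gen 5)

HONEST FRAMING: systematic search; recurrence certificates; no irrationality claim unless certified.

Bookkeeping over the 1908-point base table (`TwoTaleOmegaBaseEnum.base_cases_table`): cert-2 g4 checked `formQZ + formQTZ = 0` on the regular
1902 points grouped as `baseTab0..3` (`TwoTaleOmegaBaseQ.baseQ_all`) and `formPZ M M + D_M²·formPTev = 0` on the SAME points grouped differently, as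
the 120 chunks `basePTab<i>_<j>` of `TwoTaleOmegaBaseP0..7` (file `i` = every 8th point of the sorted table, 15 contiguous chunks).  This file
re-assembles the chunks (`basePCat<i>`, `basePCat<i>_p`), identifies the two groupings by four kernel list identities `baseTab<j> = merge of
basePCat<j>, basePCat<j+4>` (`baseTab<j>_eq_merge`), and so delivers, for every regular table point, BOTH facts (`regular_facts`) together with
`d = b+2e+2f−a−g−3 ≥ 0` (`regular_d_nonneg`); for the six points of `baseTabOdd` (`d = −1`, outside [Zu14] Prop. 1 as formalised) it records
`d = −1`, the tree's `formQZ = formQTZ` (`TwoTaleOmegaBaseQ.baseTabOdd_q`) and the NEW kernel check `formPnegEv = formPTev` (`baseTabOdd_p`), where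
`formPnegEv` is the computable value of the tree's `formP` when `d < 0` (no polynomial part; see `TwoTaleOmega/OmegaBaseValues`).  List identities and
six small evaluations only; nothing analytic is proved here.
-/

noncomputable section

namespace Summit.KontsevichZagierPeriods.Zeta5Search.Certificates

namespace TwoTaleTelescope

open Finset
open Literature.NumberTheory.Irrationality.Zudilin2014

/-- The P-table of `TwoTaleOmegaBaseP0` re-assembled (every 8th point of the sorted regular table, residue 0). -/
def basePCat0 : List Tup :=
  basePTab0_0 ++ basePTab0_1 ++ basePTab0_2 ++ basePTab0_3 ++ basePTab0_4 ++ basePTab0_5 ++ basePTab0_6 ++ basePTab0_7 ++ basePTab0_8 ++ basePTab0_9 ++ basePTab0_10 ++ basePTab0_11 ++ basePTab0_12 ++ basePTab0_13 ++ basePTab0_14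

/-- `formPZ M M + D_M²·formPTev = 0` on all of `basePCat0`. -/
theorem basePCat0_p : basePCat0.all pCoincides = true := by
  simp only [basePCat0, List.all_append, basePTab0_0_p, basePTab0_1_p, basePTab0_2_p, basePTab0_3_p, basePTab0_4_p, basePTab0_5_p, basePTab0_6_p, basePTab0_7_p, basePTab0_8_p, basePTab0_9_p, basePTab0_10_p, basePTab0_11_p, basePTab0_12_p, basePTab0_13_p, basePTab0_14_p, Bool.and_self]

/-- The P-table of `TwoTaleOmegaBaseP1` re-assembled (every 8th point of the sorted regular table, residue 1). -/
def basePCat1 : List Tup :=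
  basePTab1_0 ++ basePTab1_1 ++ basePTab1_2 ++ basePTab1_3 ++ basePTab1_4 ++ basePTab1_5 ++ basePTab1_6 ++ basePTab1_7 ++ basePTab1_8 ++ basePTab1_9 ++ basePTab1_10 ++ basePTab1_11 ++ basePTab1_12 ++ basePTab1_13 ++ basePTab1_14

/-- `formPZ M M + D_M²·formPTev = 0` on all of `basePCat1`. -/
theorem basePCat1_p : basePCat1.all pCoincides = true := by
  simp only [basePCat1, List.all_append, basePTab1_0_p, basePTab1_1_p, basePTab1_2_p, basePTab1_3_p, basePTab1_4_p, basePTab1_5_p, basePTab1_6_p, basePTab1_7_p, basePTab1_8_p, basePTab1_9_p, basePTab1_10_p, basePTab1_11_p, basePTab1_12_p, basePTab1_13_p, basePTab1_14_p, Bool.and_self]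

/-- The P-table of `TwoTaleOmegaBaseP2` re-assembled (every 8th point of the sorted regular table, residue 2). -/
def basePCat2 : List Tup :=
  basePTab2_0 ++ basePTab2_1 ++ basePTab2_2 ++ basePTab2_3 ++ basePTab2_4 ++ basePTab2_5 ++ basePTab2_6 ++ basePTab2_7 ++ basePTab2_8 ++ basePTab2_9 ++ basePTab2_10 ++ basePTab2_11 ++ basePTab2_12 ++ basePTab2_13 ++ basePTab2_14

/-- `formPZ M M + D_M²·formPTev = 0` on all of `basePCat2`. -/
theorem basePCat2_p : basePCat2.all pCoincides = true := by
  simp only [basePCat2, List.all_append, basePTab2_0_p, basePTab2_1_p, basePTab2_2_p, basePTab2_3_p, basePTab2_4_p, basePTab2_5_p, basePTab2_6_p, basePTab2_7_p, basePTab2_8_p, basePTab2_9_p, basePTab2_10_p, basePTab2_11_p, basePTab2_12_p, basePTab2_13_p, basePTab2_14_p, Bool.and_self]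

/-- The P-table of `TwoTaleOmegaBaseP3` re-assembled (every 8th point of the sorted regular table, residue 3). -/
def basePCat3 : List Tup :=
  basePTab3_0 ++ basePTab3_1 ++ basePTab3_2 ++ basePTab3_3 ++ basePTab3_4 ++ basePTab3_5 ++ basePTab3_6 ++ basePTab3_7 ++ basePTab3_8 ++ basePTab3_9 ++ basePTab3_10 ++ basePTab3_11 ++ basePTab3_12 ++ basePTab3_13 ++ basePTab3_14

/-- `formPZ M M + D_M²·formPTev = 0` on all of `basePCat3`. -/
theorem basePCat3_p : basePCat3.all pCoincides = true := by
  simp only [basePCat3, List.all_append, basePTab3_0_p, basePTab3_1_p, basePTab3_2_p, basePTab3_3_p, basePTab3_4_p, basePTab3_5_p, basePTab3_6_p, basePTab3_7_p, basePTab3_8_p, basePTab3_9_p, basePTab3_10_p, basePTab3_11_p, basePTab3_12_p, basePTab3_13_p, basePTab3_14_p, Bool.and_self]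

/-- The P-table of `TwoTaleOmegaBaseP4` re-assembled (every 8th point of the sorted regular table, residue 4). -/
def basePCat4 : List Tup :=
  basePTab4_0 ++ basePTab4_1 ++ basePTab4_2 ++ basePTab4_3 ++ basePTab4_4 ++ basePTab4_5 ++ basePTab4_6 ++ basePTab4_7 ++ basePTab4_8 ++ basePTab4_9 ++ basePTab4_10 ++ basePTab4_11 ++ basePTab4_12 ++ basePTab4_13 ++ basePTab4_14

/-- `formPZ M M + D_M²·formPTev = 0` on all of `basePCat4`. -/
theorem basePCat4_p : basePCat4.all pCoincides = true := by
  simp only [basePCat4, List.all_append, basePTab4_0_p, basePTab4_1_p, basePTab4_2_p, basePTab4_3_p, basePTab4_4_p, basePTab4_5_p, basePTab4_6_p, basePTab4_7_p, basePTab4_8_p, basePTab4_9_p, basePTab4_10_p, basePTab4_11_p, basePTab4_12_p, basePTab4_13_p, basePTab4_14_p, Bool.and_self]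

/-- The P-table of `TwoTaleOmegaBaseP5` re-assembled (every 8th point of the sorted regular table, residue 5). -/
def basePCat5 : List Tup :=
  basePTab5_0 ++ basePTab5_1 ++ basePTab5_2 ++ basePTab5_3 ++ basePTab5_4 ++ basePTab5_5 ++ basePTab5_6 ++ basePTab5_7 ++ basePTab5_8 ++ basePTab5_9 ++ basePTab5_10 ++ basePTab5_11 ++ basePTab5_12 ++ basePTab5_13 ++ basePTab5_14

/-- `formPZ M M + D_M²·formPTev = 0` on all of `basePCat5`. -/
theorem basePCat5_p : basePCat5.all pCoincides = true := by
  simp only [basePCat5, List.all_append, basePTab5_0_p, basePTab5_1_p, basePTab5_2_p, basePTab5_3_p, basePTab5_4_p, basePTab5_5_p, basePTab5_6_p, basePTab5_7_p, basePTab5_8_p, basePTab5_9_p, basePTab5_10_p, basePTab5_11_p, basePTab5_12_p, basePTab5_13_p, basePTab5_14_p, Bool.and_self]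

/-- The P-table of `TwoTaleOmegaBaseP6` re-assembled (every 8th point of the sorted regular table, residue 6). -/
def basePCat6 : List Tup :=
  basePTab6_0 ++ basePTab6_1 ++ basePTab6_2 ++ basePTab6_3 ++ basePTab6_4 ++ basePTab6_5 ++ basePTab6_6 ++ basePTab6_7 ++ basePTab6_8 ++ basePTab6_9 ++ basePTab6_10 ++ basePTab6_11 ++ basePTab6_12 ++ basePTab6_13 ++ basePTab6_14

/-- `formPZ M M + D_M²·formPTev = 0` on all of `basePCat6`. -/
theorem basePCat6_p : basePCat6.all pCoincides = true := by
  simp only [basePCat6, List.all_append, basePTab6_0_p, basePTab6_1_p, basePTab6_2_p, basePTab6_3_p, basePTab6_4_p, basePTab6_5_p, basePTab6_6_p, basePTab6_7_p, basePTab6_8_p, basePTab6_9_p, basePTab6_10_p, basePTab6_11_p, basePTab6_12_p, basePTab6_13_p, basePTab6_14_p, Bool.and_self]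

/-- The P-table of `TwoTaleOmegaBaseP7` re-assembled (every 8th point of the sorted regular table, residue 7). -/
def basePCat7 : List Tup :=
  basePTab7_0 ++ basePTab7_1 ++ basePTab7_2 ++ basePTab7_3 ++ basePTab7_4 ++ basePTab7_5 ++ basePTab7_6 ++ basePTab7_7 ++ basePTab7_8 ++ basePTab7_9 ++ basePTab7_10 ++ basePTab7_11 ++ basePTab7_12 ++ basePTab7_13 ++ basePTab7_14

/-- `formPZ M M + D_M²·formPTev = 0` on all of `basePCat7`. -/
theorem basePCat7_p : basePCat7.all pCoincides = true := by
  simp only [basePCat7, List.all_append, basePTab7_0_p, basePTab7_1_p, basePTab7_2_p, basePTab7_3_p, basePTab7_4_p, basePTab7_5_p, basePTab7_6_p, basePTab7_7_p, basePTab7_8_p, basePTab7_9_p, basePTab7_10_p, basePTab7_11_p, basePTab7_12_p, basePTab7_13_p, basePTab7_14_p, Bool.and_self]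

set_option maxHeartbeats 4000000 in
set_option maxRecDepth 100000 in
/-- The two groupings agree: `baseTab0` (every 4th sorted point) is the merge of `basePCat0` and `basePCat4` (one kernel evaluation). -/
theorem baseTab0_eq_merge : baseTab0 = mergeF lexLE 600 basePCat0 basePCat4 := by
  decide +kernel

set_option maxHeartbeats 4000000 in
set_option maxRecDepth 100000 in
/-- The two groupings agree: `baseTab1` (every 4th sorted point) is the merge of `basePCat1` and `basePCat5` (one kernel evaluation). -/
theorem baseTab1_eq_merge : baseTab1 = mergeF lexLE 600 basePCat1 basePCat5 := by
  decide +kernel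

set_option maxHeartbeats 4000000 in
set_option maxRecDepth 100000 in
/-- The two groupings agree: `baseTab2` (every 4th sorted point) is the merge of `basePCat2` and `basePCat6` (one kernel evaluation). -/
theorem baseTab2_eq_merge : baseTab2 = mergeF lexLE 600 basePCat2 basePCat6 := by
  decide +kernel

set_option maxHeartbeats 4000000 in
set_option maxRecDepth 100000 in
/-- The two groupings agree: `baseTab3` (every 4th sorted point) is the merge of `basePCat3` and `basePCat7` (one kernel evaluation). -/
theorem baseTab3_eq_merge : baseTab3 = mergeF lexLE 600 basePCat3 basePCat7 := by
  decide +kernel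

/-- `p = −p̂` (cert-2 g4's integer form) at a point of `baseTab<j>`, read off the P-chunks through the merge identity. -/
theorem pCoincides_of_mem {q : Tup} (h : q ∈ baseTab0 ++ baseTab1 ++ baseTab2 ++ baseTab3) : pCoincides q = true := by
  simp only [List.mem_append] at h
  rcases h with ((h | h) | h) | h
  · rw [baseTab0_eq_merge] at h
    rcases mem_mergeF _ _ _ _ _ h with h | h
    · exact List.all_eq_true.mp basePCat0_p q h
    · exact List.all_eq_true.mp basePCat4_p q h
  · rw [baseTab1_eq_merge] at h
    rcases mem_mergeF _ _ _ _ _ h with h | h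
    · exact List.all_eq_true.mp basePCat1_p q h
    · exact List.all_eq_true.mp basePCat5_p q h
  · rw [baseTab2_eq_merge] at h
    rcases mem_mergeF _ _ _ _ _ h with h | h
    · exact List.all_eq_true.mp basePCat2_p q h
    · exact List.all_eq_true.mp basePCat6_p q h
  · rw [baseTab3_eq_merge] at h
    rcases mem_mergeF _ _ _ _ _ h with h | h
    · exact List.all_eq_true.mp basePCat3_p q h
    · exact List.all_eq_true.mp basePCat7_p q h

/-- `d(q) = b + 2e + 2f − a − g − 3` of a table point. -/
def dTup (q : Tup) : ℤ := q.2.1 + 2 * q.2.2.1 + 2 * q.2.2.2.1 - q.1 - q.2.2.2.2 - 3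

set_option maxHeartbeats 4000000 in
/-- Every regular table point has `d ≥ 0` (one kernel evaluation). -/
theorem regular_d_nonneg_all : ((baseTab0 ++ baseTab1 ++ baseTab2 ++ baseTab3).all fun q => decide (0 ≤ dTup q)) = true := by
  decide +kernel

/-- **The facts at a regular table point**: `d ≥ 0`, `formQZ + formQTZ = 0`, `formPZ M M + D_M²·formPTev = 0` (`M = baseM q`). -/
theorem regular_facts {q : Tup} (h : q ∈ baseTab0 ++ baseTab1 ++ baseTab2 ++ baseTab3) :
    0 ≤ dTup q ∧ formQZ (tale1A q) (tale1B q) + formQTZ (tale2A q) (tale2B q) = 0 ∧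
      (formPZ (tale1A q) (tale1B q) (baseM q) (baseM q) : ℚ) +
        ((Nat.lcmUpto (baseM q) : ℚ) * Nat.lcmUpto (baseM q)) * formPTev (tale2A q) (tale2B q) = 0 := by
  refine ⟨?_, baseQ_all q h, ?_⟩
  · have := List.all_eq_true.mp regular_d_nonneg_all q h
    exact of_decide_eq_true this
  · have := pCoincides_of_mem h
    simpa [pCoincides] using this

/-- The value of the tree's `formP a b` when `d < 0` (then `dExp = 0` and the polynomial part vanishes, `TwoTaleOmega/OmegaBaseValues.formP_eq_negEv`):
`Σ_k C_k · H₂(k − a₂*)` with the integer coefficients `coefCZ`. -/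
def formPnegEv (a b : Fin 4 → ℤ) : ℚ := ∑ k ∈ Ico (amax a) (b 3), (coefCZ a b k : ℚ) * harmTwo (k - a2star a).toNat

set_option maxHeartbeats 4000000 in
/-- **NEW base check at the six odd points**: there `formP = formPT` in the tree's conventions, i.e. `formPnegEv (tale 1) = formPTev (tale 2)`
(one kernel evaluation; with Zudilin's sign `(−1)^d = −1` restored this is `p = −p̂`, as fam-tele's `base_verify.py` reports). -/
theorem baseTabOdd_p : (baseTabOdd.all fun q => formPnegEv (tale1A q) (tale1B q) == formPTev (tale2A q) (tale2B q)) = true := by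
  decide +kernel

/-- **The facts at an odd table point**: `d = −1`, `formQZ = formQTZ`, `formPnegEv = formPTev`. -/
theorem odd_facts {q : Tup} (h : q ∈ baseTabOdd) :
    dTup q = -1 ∧ formQZ (tale1A q) (tale1B q) = formQTZ (tale2A q) (tale2B q) ∧
      formPnegEv (tale1A q) (tale1B q) = formPTev (tale2A q) (tale2B q) := by
  have hd : (baseTabOdd.all fun q => decide (dTup q = -1)) = true := by decide
  refine ⟨of_decide_eq_true (List.all_eq_true.mp hd q h), ?_, ?_⟩
  · have := List.all_eq_true.mp baseTabOdd_q q h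
    have : formQZ (tale1A q) (tale1B q) - formQTZ (tale2A q) (tale2B q) = 0 := by simpa [qCoincidesOdd] using this
    linarith
  · have := List.all_eq_true.mp baseTabOdd_p q h
    simpa using this

end TwoTaleTelescope

end Summit.KontsevichZagierPeriods.Zeta5Search.Certificates

end
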